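/-
Copyright (c) 2026 The HCML crux team. All rights reserved.
Released under Apache 2.0 license as described in the file LICENSE.
Authors: K2E3-p17 (g8) (explicit-unit `hodgecm-mathlib-K2E3-p17-g8`) — the `N = 2` twin of ★ (GL-3b) `K2E3GL3FinConj` ∕ ★ (B1⁰) `K2E3GL3FinConjAdmissible` by K2E3-p23 (g4)
-/
import Summits.HodgeConjecture.HodgeConjecture.Theorems.K2E3GL2TorusAveraging                  -- ★ (2E-a4) p858919 (K2E5-p17 (g5)): `measure_inter_coll_le`; brings ★ (2E-a1) boxes, ★ (2F-a) `Ḡ`, `K̄`, one-parameter Cartan cover, compactness criterion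
import Summits.HodgeConjecture.HodgeConjecture.Theorems.K2E3GL2HenselSplitCentralizerCompact    -- ★ p858936 (K2E3-p21 (g6)) over ★ (2E-a3) p858905 (K2E5-p17 (g5)): `v_diffSq_lt_of_isCompact_centralizer`
import Summits.HodgeConjecture.HodgeConjecture.Theorems.K2E3GL2ModCentreUnimodular              -- ★ (2F-a′) p858754 (K2E5-p17 (g5)): `Ḡ = GL₂(F) ⧸ Z` is unimodular
import Summits.HodgeConjecture.HodgeConjecture.Theorems.K2E3GL3FinConj                          -- ★ (GL-3b) p857612 (K2E3-p23 (g4)): generic `smul_boxPair_eq`; brings ★ (F3a′∕F3a‴) assembly, ★ (F1) boxes, ★ tails `pow_le_rpow_quarter_pow` ∕ `rpow_pow_comm`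
import Literature.NumberTheory.Automorphic.IwasawaDecompositionGL                               -- ★ `diagonalGL_mem_glInt`, `zpowDiagGL`
import Summits.HodgeConjecture.HodgeConjecture.Theorems.K2E3GL2FinConjAdmissible                -- ★ (2E-b1) p858938 (K2E3-p24 (g0)): `finConjGL_cc` ∕ `finConjGL` hypothesis-first on this file's head (assembled in §3)
import HarnessLib

/-!
# (GL₂-sc, 2E-a5) Finiteness of the conjugation-fibre integral on `Ḡ = GL₂(F) ⧸ Z` over an admissible domain — `finConjGL_of_admissible`

Cell `hodgecm-mathlib`, Track B, line `K2_E3_EllipticInputs`; road «GL₂-sc» = Harish-Chandra's local integrability for supercuspidal `GL₂(F)` (letter (S-C′-GL₂sc)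
`sig_K2E3GL2SupercuspidalCharLocInt` of the hosted leaf (nsc-S-C′); road owner K2E5-p17 (g5), BRICK LIST v1.1 `K2/K2E5-p17/g5/BRICKLIST-GL2sc-v1.1.K2E5-p17-g5.md`,
ASSIGNMENTS 2026-09-04T09:19:45Z ∕ 09:21:21Z; dealer K2E3-plan (g4) D70).  THE THEOREM (the `N = 2` image of ★ (B1⁰) `K2E3GL3FinConjAdmissible.finConjGL_of_admissible`,
binder letters verbatim with `Fin 3 ↦ Fin 2`, as asked by the consumer K2E3-p24 (g0) (2E-b1)): for `F` a non-archimedean local field of characteristic `0`, `Ḡ = GL₂(F) ⧸ Z`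
with a Haar measure `μ̄`, `C ⊆ Ḡ` compact, `β ≥ 0` continuous, bounded, compactly supported, and `A ⊆ C` ADMISSIBLE (every `ḡ ∈ A` whose orbit meets `{β ≠ 0}` has
compact centraliser),

  **`∫_{A} ∫ β(x̄ ḡ x̄⁻¹) dμ̄(x̄) dμ̄(ḡ) < ∞`**

— Harish-Chandra's finiteness of the orbital-integral function on the elliptic set, the analytic input of the local integrability of supercuspidal characters of `GL₂`
modulo the centre.  PROOF = ★ GL-3b ∕ B1⁰ transplanted to `N = 2` (ONE-parameter Cartan cover, ONE near-Borel shape): `K₀ := K̄` (★ 2F-a), the cover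
`Ḡ = ⋃_{a ≥ 0} K̄ t̄_a K̄`, `t_a = diag(ϖ^{−a}, 1)` (★ 2F-a `exists_mem_doubleCoset_mk_tOne`), unimodularity (★ 2F-a′), `Ω̄ := K̄ (C ∪ tsupport β) K̄`; a NORMALISED lift `h`
of a box element (★ 2E-a1 + ★ 2F-a compactness criterion) has entries `≤ exp 2N`, `v(det h) ≥ exp(−4N)` and `v(h₀₁) ≤ exp(2N − a)` (★ 2F-a `v_upper_le_of_conj_tOne`);
for `a ≥ 64N + 4` a compact centraliser forces the diagonal collision `v((h₀₀ − h₁₁)²) < exp(−k)`, `k = (a − 8N − 1)∕2` (★ `v_diffSq_lt_of_isCompact_centralizer`, K2E3-p21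
(g6) over ★ 2E-a3), made RELATIVE by ★ 2E-a1's diagonal lower bound `v(h₀₀) ≥ exp(−6N)` (`h̄ ∈ N_j`, `j = k − 12N`); ★ (2E-a4) gives `μ̄(box ∩ N_j) ≤ C |ϖ^j|^κ μ̄(box)` and
`|ϖ|^{κ j} ≲ s^a ≤ σ^a` (`a ≤ 4j + 64N + 4`) is summable over `a`; ★ F3a‴ `lintegral_fibre_lt_top_of_boxDecay_of_admissible` assembles.

§1 `tsum_geometric_mul_ne_top`; §2 **`finConjGL_of_admissible`**; §3 the two ASSEMBLED heads **`finConjGL_cc`** (`A = C ∩ {Z_Ḡ(ḡ) compact}`) and **`finConjGL`**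
(`A = C ∩ {W(ḡ) < ⊤}`) — ★ (2E-b1) `K2E3GL2FinConjAdmissible.finConjGL_cc` ∕ `.finConjGL` (K2E3-p24 (g0), hypothesis-first on `hFC`) with `hFC := finConjGL_of_admissible hϖ μ`
plugged, so both GL₂ finiteness statements exist BY NAME with no binder left.

HONEST LABEL: HC_CM is proved only modulo the 7 printed citations (2 remaining named inputs: hLiu418 = stmt-HodgeConjecture-24832, h413 =
stmt-HodgeConjecture-24833) until rung 0 closes; this file is count-neutral (kernel lane `--supports stmt-HodgeConjecture-24833 --as helper`): it is the elliptic-half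
ANALYTIC organ of road «GL₂-sc»; the socket is paid by the road owner's (2A-2), not here.

References: Harish-Chandra (van Dijk) 1970, Part VII §2 [cite: HarishChandra1970, Part VII §2 p. 69]; Jacquet–Langlands 1970 §7 (characters of supercuspidal
representations of `GL₂` are locally integrable) [cite: JacquetLanglands1970, §7]; Cartier 1979 §IV [cite: Cartier1979, §IV.1].
-/

open MeasureTheory MeasureTheory.Measure Set Function
open scoped NNReal ENNReal MatrixGroups Pointwise WithZero Valued Topology
open ValuativeRel Matrix
open Literature.NumberTheory.Automorphic Literature.NumberTheory.GaloisRepresentations Literature.NumberTheory.GaloisRepresentations.IsNonarchimedeanLocalField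
open Summit.HodgeConjecture.HodgeConjecture.Cruxes.H413.K2E3GL2ModCentre Summit.HodgeConjecture.HodgeConjecture.Cruxes.H413.K2E3GL2FinConjBoxes
open Summit.HodgeConjecture.HodgeConjecture.Cruxes.H413.K2E3GL2HenselSplitCentralizerCompact
open Summit.HodgeConjecture.HodgeConjecture.Cruxes.H413.K2E3FinConjCartanCover Summit.HodgeConjecture.HodgeConjecture.Cruxes.H413.K2E3FinConjOfBoxDecay
open Summit.HodgeConjecture.HodgeConjecture.Cruxes.H413.K2E3GeometricTailSummable Summit.HodgeConjecture.HodgeConjecture.Cruxes.H413.K2E3SplitTorusTwistModuleBound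

set_option linter.dupNamespace false

namespace Summit.HodgeConjecture.HodgeConjecture.Cruxes.H413.K2E3GL2FinConj

/-! ## §1 The single geometric sum -/

/-- **THE SINGLE SUM**: `Σ_{a ≥ 0} D σ^a = D (1 − σ)⁻¹ < ⊤` for `σ < 1`, `D ≠ ⊤`. [cite: Rudin1976, Thm. 3.26] -/
theorem tsum_geometric_mul_ne_top {D σ : ℝ≥0∞} (hD : D ≠ ⊤) (hσ : σ < 1) : ∑' a : ℕ, D * σ ^ a ≠ ⊤ := by
  have hgeo : ∑' n : ℕ, σ ^ n ≠ ⊤ := by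
    rw [ENNReal.tsum_geometric, ne_eq, ENNReal.inv_eq_top, tsub_eq_zero_iff_le, not_le]
    exact hσ
  rw [ENNReal.tsum_mul_left]
  exact ENNReal.mul_ne_top hD hgeo

/-! ## §2 `finConjGL_of_admissible` -/

section Main

/-- **(GL₂-sc, 2E-a5) FINITENESS OF THE CONJUGATION-FIBRE INTEGRAL ON `GL₂(F) ⧸ Z` OVER AN ADMISSIBLE DOMAIN.**  For `F` a non-archimedean local field of
characteristic `0`, uniformizer `ϖ`, `Ḡ = GL₂(F) ⧸ Z` with a Haar measure `μ̄`, `C ⊆ Ḡ` compact, `β : Ḡ → [0, Mb]` continuous with compact support (`Mb < ∞`), and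
every `A ⊆ C` such that each `ḡ ∈ A` whose orbit meets `{β ≠ 0}` has compact centraliser: `∫⁻_{A} ∫⁻ β(x̄ ḡ x̄⁻¹) dμ̄ dμ̄ < ⊤` — ★ (B1⁰) `finConjGL_of_admissible` with
`Fin 3 ↦ Fin 2` (one-parameter Cartan cover ★ 2F-a, normalised lifts ★ 2E-a1, compact centraliser ⇒ diagonal collision ★ 2E-a3 (-Compact), torus averaging ★ 2E-a4,
assembly ★ F3a‴).  [cite: HarishChandra1970, Part VII §2 p. 69] [cite: JacquetLanglands1970, §7] [cite: Cartier1979, §IV.1] -/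
theorem finConjGL_of_admissible {F : Type*} [Field F] [Valued F ℤᵐ⁰] [ValuativeRel F] [(Valued.v : Valuation F ℤᵐ⁰).Compatible] [IsNonarchimedeanLocalField F] [CharZero F]
    {ϖ : F} (hϖ : Valued.v ϖ = WithZero.exp (-1 : ℤ))
    [MeasurableSpace (GL (Fin 2) F ⧸ Subgroup.center (GL (Fin 2) F))] [BorelSpace (GL (Fin 2) F ⧸ Subgroup.center (GL (Fin 2) F))]
    (μ : Measure (GL (Fin 2) F ⧸ Subgroup.center (GL (Fin 2) F))) [μ.IsHaarMeasure]
    {C : Set (GL (Fin 2) F ⧸ Subgroup.center (GL (Fin 2) F))} (hC : IsCompact C)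
    {β : (GL (Fin 2) F ⧸ Subgroup.center (GL (Fin 2) F)) → ℝ≥0∞} (hβ : Continuous β) (hβs : IsCompact (tsupport β))
    {Mb : ℝ≥0∞} (hMb : Mb ≠ ⊤) (hβM : ∀ g, β g ≤ Mb)
    {A : Set (GL (Fin 2) F ⧸ Subgroup.center (GL (Fin 2) F))} (hAC : A ⊆ C)
    (hAZ : ∀ x : GL (Fin 2) F ⧸ Subgroup.center (GL (Fin 2) F), ∀ g ∈ A, x * g * x⁻¹ ∈ {u : GL (Fin 2) F ⧸ Subgroup.center (GL (Fin 2) F) | β u ≠ 0} →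
      g ∈ {h : GL (Fin 2) F ⧸ Subgroup.center (GL (Fin 2) F) | IsCompact ((Subgroup.centralizer ({h} : Set (GL (Fin 2) F ⧸ Subgroup.center (GL (Fin 2) F)))) :
        Set (GL (Fin 2) F ⧸ Subgroup.center (GL (Fin 2) F)))}) :
    ∫⁻ g in A, ∫⁻ x, β (x * g * x⁻¹) ∂μ ∂μ < ⊤ := by
  -- §0 frame
  haveI : SecondCountableTopology (GL (Fin 2) F) := secondCountableTopology_gl2 F
  haveI : LocallyCompactSpace (GL (Fin 2) F) := locallyCompactSpace_gl2 F
  haveI : T2Space (GL (Fin 2) F ⧸ Subgroup.center (GL (Fin 2) F)) := t2Space_quot F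
  haveI : μ.IsMulRightInvariant := K2E3GL2ModCentreUnimodular.isMulRightInvariant_quot_of_isHaarMeasure hϖ μ
  have hϖ0 : ϖ ≠ 0 := fun h => by rw [h, map_zero] at hϖ; exact WithZero.zero_ne_coe hϖ
  -- §1 `K̄`, the one-parameter Cartan family, the cover
  set Kb : Subgroup (GL (Fin 2) F ⧸ Subgroup.center (GL (Fin 2) F)) := (glInt 2 F).map (QuotientGroup.mk' (Subgroup.center (GL (Fin 2) F))) with hKb
  have hKo : IsOpen (Kb : Set (GL (Fin 2) F ⧸ Subgroup.center (GL (Fin 2) F))) := isOpen_kbar F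
  have hKc : IsCompact (Kb : Set (GL (Fin 2) F ⧸ Subgroup.center (GL (Fin 2) F))) := isCompact_kbar F
  set tt : ℕ → GL (Fin 2) F := fun a => zpowDiagGL (n := 2) hϖ0 ![-(a : ℤ), 0] with htt
  set t : ℕ → GL (Fin 2) F ⧸ Subgroup.center (GL (Fin 2) F) :=
    fun a => QuotientGroup.mk' (Subgroup.center (GL (Fin 2) F)) (zpowDiagGL (n := 2) hϖ0 ![-(a : ℤ), 0]) with ht
  have hcov : ∀ x : GL (Fin 2) F ⧸ Subgroup.center (GL (Fin 2) F), ∃ a,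
      x ∈ (Kb : Set (GL (Fin 2) F ⧸ Subgroup.center (GL (Fin 2) F))) * {t a} * (Kb : Set (GL (Fin 2) F ⧸ Subgroup.center (GL (Fin 2) F))) := by
    intro x
    obtain ⟨a, ha⟩ := exists_mem_doubleCoset_mk_tOne hϖ hϖ0 x
    exact ⟨a, ha⟩
  have htmk : ∀ a, t a = (QuotientGroup.mk (tt a) : GL (Fin 2) F ⧸ Subgroup.center (GL (Fin 2) F)) := fun a => rfl
  -- §2 the box `Ω̄ = K̄ (C ∪ tsupport β) K̄`
  set S₀ : Set (GL (Fin 2) F ⧸ Subgroup.center (GL (Fin 2) F)) := C ∪ tsupport β with hS₀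
  have hS₀c : IsCompact S₀ := hC.union hβs
  set Ω : Set (GL (Fin 2) F ⧸ Subgroup.center (GL (Fin 2) F)) :=
    (Kb : Set (GL (Fin 2) F ⧸ Subgroup.center (GL (Fin 2) F))) * S₀ * (Kb : Set (GL (Fin 2) F ⧸ Subgroup.center (GL (Fin 2) F))) with hΩ
  have hΩc : IsCompact Ω := isCompact_box _ hKc hS₀c
  have hΩm : MeasurableSet Ω := hΩc.isClosed.measurableSet
  have hCΩ : C ⊆ Ω := (Set.subset_union_left).trans (subset_box _ S₀)
  have hβΩ : ∀ g, β g ≠ 0 → g ∈ Ω := fun g hg => subset_box _ S₀ (Set.subset_union_right (subset_tsupport β hg))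
  have hΩl : ∀ k ∈ Kb, ∀ g, k * g ∈ Ω ↔ g ∈ Ω := fun k hk g => mul_mem_box_iff _ S₀ hk g
  have hΩr : ∀ k ∈ Kb, ∀ g, g * k ∈ Ω ↔ g ∈ Ω := fun k hk g => mem_box_mul_iff _ S₀ hk g
  obtain ⟨Fs, hΩF⟩ := exists_finset_subset_biUnion_smul Kb hKo hΩc
  obtain ⟨N, hN⟩ := exists_bound_of_isCompact_image hϖ hΩc
  -- §3 a Haar measure on `Fˣ` and the (2E-a4) decay package
  letI : MeasurableSpace Fˣ := borel Fˣ
  haveI : BorelSpace Fˣ := ⟨rfl⟩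
  haveI : SecondCountableTopology Fˣ := secondCountableTopology_units F
  obtain ⟨κ, hκ0, Cm, hCmT, h5⟩ := K2E3GL2TorusAveraging.measure_inter_coll_le (Measure.haar : Measure Fˣ) μ hϖ
  -- §4 constants: `x = |ϖ|`, `ρ = x^κ`, `s = ρ^{1/4}`, `σ = max(s, 1/2)`, `c = 64N + 4`, `D`, `ε`
  set x : ℝ≥0∞ := ((normAbs F ϖ : ℝ≥0) : ℝ≥0∞) with hx
  have hx1 : x < 1 := by
    have hv : Valued.v ϖ < Valued.v (1 : F) := by
      rw [hϖ, map_one, ← WithZero.exp_zero]; exact WithZero.exp_lt_exp.2 (by norm_num)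
    have hle : normAbs F ϖ ≤ normAbs F 1 := (v_le_iff_normAbs_le _ _).1 hv.le
    have hne : normAbs F ϖ ≠ normAbs F 1 := fun h => hv.ne ((v_eq_iff_normAbs_eq _ _).2 h)
    rw [map_one] at hle hne
    rw [hx]; exact_mod_cast lt_of_le_of_ne hle hne
  have hx0 : x ≠ 0 := by rw [hx]; exact_mod_cast (map_ne_zero (normAbs F)).2 hϖ0
  have hxT : x ≠ ⊤ := ENNReal.coe_ne_top
  set ρ : ℝ≥0∞ := x ^ κ with hρ
  have hρ1 : ρ < 1 := ENNReal.rpow_lt_one hx1 hκ0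
  have hρ0 : ρ ≠ 0 := (ENNReal.rpow_pos (pos_iff_ne_zero.2 hx0) hxT).ne'
  have hρT : ρ ≠ ⊤ := (hρ1.trans ENNReal.one_lt_top).ne
  set s : ℝ≥0∞ := ρ ^ (1 / 4 : ℝ) with hs
  have hs1 : s < 1 := ENNReal.rpow_lt_one hρ1 (by norm_num)
  have hs0 : s ≠ 0 := (ENNReal.rpow_pos (pos_iff_ne_zero.2 hρ0) hρT).ne'
  set σ : ℝ≥0∞ := max s 2⁻¹ with hσ
  have hσ1 : σ < 1 := max_lt hs1 (by norm_num)
  set c : ℕ := 64 * N + 4 with hc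
  set D : ℝ≥0∞ := Cm * (s ^ c)⁻¹ + 2 ^ c with hD
  have hscT : (s ^ c)⁻¹ ≠ ⊤ := by rw [ne_eq, ENNReal.inv_eq_top]; exact pow_ne_zero _ hs0
  have hDT : D ≠ ⊤ := ENNReal.add_ne_top.2 ⟨ENNReal.mul_ne_top hCmT hscT, ENNReal.pow_ne_top ENNReal.ofNat_ne_top⟩
  set ε : ℕ → ℝ≥0∞ := fun a => D * σ ^ a with hε
  have hεsum : ∑' a, ε a ≠ ⊤ := tsum_geometric_mul_ne_top hDT hσ1
  -- `ε ≥ 1` on the finitely many small indices, and the geometric majorant of the (2E-a4) constant on the large ones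
  have hε1 : ∀ a : ℕ, a < c → 1 ≤ ε a := by
    intro a ha
    have h2 : (2 : ℝ≥0∞)⁻¹ ^ a ≤ σ ^ a := pow_le_pow_left' (le_max_right _ _) _
    have h3 : (1 : ℝ≥0∞) ≤ 2 ^ c * (2 : ℝ≥0∞)⁻¹ ^ a := by
      have h4 : (2 : ℝ≥0∞)⁻¹ ^ c ≤ (2 : ℝ≥0∞)⁻¹ ^ a := pow_le_pow_right_of_le_one' (ENNReal.inv_le_one.2 one_le_two) ha.le
      calc (1 : ℝ≥0∞) = 2 ^ c * (2 : ℝ≥0∞)⁻¹ ^ c := by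
            rw [← mul_pow, ENNReal.mul_inv_cancel two_ne_zero ENNReal.ofNat_ne_top, one_pow]
        _ ≤ 2 ^ c * (2 : ℝ≥0∞)⁻¹ ^ a := mul_le_mul' le_rfl h4
    calc (1 : ℝ≥0∞) ≤ 2 ^ c * (2 : ℝ≥0∞)⁻¹ ^ a := h3
      _ ≤ D * σ ^ a := mul_le_mul' (by rw [hD]; exact le_add_self) h2
  have hεmaj : ∀ a j : ℕ, a ≤ 4 * j + c → Cm * ((normAbs F (ϖ ^ j) : ℝ≥0) : ℝ≥0∞) ^ κ ≤ ε a := by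
    intro a j hj
    -- `|ϖ^j|^κ = ρ^j`
    have h1 : ((normAbs F (ϖ ^ j) : ℝ≥0) : ℝ≥0∞) ^ κ ≤ ρ ^ j := by
      rw [map_pow, ENNReal.coe_pow, rpow_pow_comm, hρ]
    -- `ρ^j ≤ s^a (s^c)⁻¹ ≤ σ^a (s^c)⁻¹`
    have h2 : ρ ^ j ≤ s ^ a * (s ^ c)⁻¹ := pow_le_rpow_quarter_pow hρ0 hρ1.le hρT hj
    have h3 : s ^ a ≤ σ ^ a := pow_le_pow_left' (le_max_left _ _) _
    calc Cm * ((normAbs F (ϖ ^ j) : ℝ≥0) : ℝ≥0∞) ^ κ ≤ Cm * (s ^ a * (s ^ c)⁻¹) := mul_le_mul' le_rfl (h1.trans h2)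
      _ ≤ Cm * (σ ^ a * (s ^ c)⁻¹) := mul_le_mul' le_rfl (mul_le_mul' h3 le_rfl)
      _ = Cm * (s ^ c)⁻¹ * σ ^ a := by ring
      _ ≤ D * σ ^ a := mul_le_mul' (by rw [hD]; exact le_self_add) le_rfl
  -- §5 the decay on each box
  have hdecay : ∀ a, μ (Ω ∩ {h : GL (Fin 2) F ⧸ Subgroup.center (GL (Fin 2) F) | t a * h * (t a)⁻¹ ∈ Ω} ∩
      {h : GL (Fin 2) F ⧸ Subgroup.center (GL (Fin 2) F) | IsCompact ((Subgroup.centralizer ({h} : Set (GL (Fin 2) F ⧸ Subgroup.center (GL (Fin 2) F)))) :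
        Set (GL (Fin 2) F ⧸ Subgroup.center (GL (Fin 2) F)))}) ≤
      μ (Ω ∩ {h : GL (Fin 2) F ⧸ Subgroup.center (GL (Fin 2) F) | t a * h * (t a)⁻¹ ∈ Ω}) * ε a := by
    intro a
    set box : Set (GL (Fin 2) F ⧸ Subgroup.center (GL (Fin 2) F)) := Ω ∩ {h | t a * h * (t a)⁻¹ ∈ Ω} with hbox
    by_cases hsmall : a < c
    · exact (measure_mono Set.inter_subset_left).trans (le_mul_of_one_le_right zero_le (hε1 a hsmall))
    rw [not_lt] at hsmall
    -- measurability and torus invariance of the box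
    have hboxm : MeasurableSet box :=
      hΩm.inter (hΩm.preimage ((continuous_const.mul continuous_id).mul continuous_const).measurable)
    have hcomm : ∀ (d : Fin 2 → Fˣ) (e : Fin 2 → ℤ), diagonalGL (Fin 2) F d * zpowDiagGL hϖ0 e = zpowDiagGL hϖ0 e * diagonalGL (Fin 2) F d := by
      intro d e
      rw [zpowDiagGL, ← map_mul, ← map_mul, mul_comm]
    have htorus : ∀ d : Fin 2 → Fˣ, (∀ i, valuation F ((d i : Fˣ) : F) = 1) →
        (QuotientGroup.mk (diagonalGL (Fin 2) F d) : GL (Fin 2) F ⧸ Subgroup.center (GL (Fin 2) F)) • box = box := by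
      intro d hd
      have hsK : (QuotientGroup.mk (diagonalGL (Fin 2) F d) : GL (Fin 2) F ⧸ Subgroup.center (GL (Fin 2) F)) ∈ Kb :=
        Subgroup.mem_map.2 ⟨diagonalGL (Fin 2) F d, diagonalGL_mem_glInt hd, rfl⟩
      have hst : (QuotientGroup.mk (diagonalGL (Fin 2) F d) : GL (Fin 2) F ⧸ Subgroup.center (GL (Fin 2) F)) * t a =
          t a * QuotientGroup.mk (diagonalGL (Fin 2) F d) := by
        rw [htmk, ← QuotientGroup.mk_mul, ← QuotientGroup.mk_mul, htt]
        exact congrArg _ (hcomm d _)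
      exact K2E3GL3FinConj.smul_boxPair_eq Kb S₀ hsK hst
    have htorusI : ∀ u : Fˣ, valuation F (u : F) = 1 →
        (QuotientGroup.mk (diagonalGL (Fin 2) F ![u, 1]) : GL (Fin 2) F ⧸ Subgroup.center (GL (Fin 2) F)) • box = box := fun u hu =>
      htorus _ fun i => by
        have hi : i = 0 ∨ i = 1 := by decide +revert
        rcases hi with rfl | rfl
        · exact hu
        · simp
    -- the normalised lift of a box element and its entries
    have hlift : ∀ z ∈ box, ∃ h : GL (Fin 2) F, (QuotientGroup.mk h : GL (Fin 2) F ⧸ Subgroup.center (GL (Fin 2) F)) = z ∧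
        (∀ i j, Valued.v ((h : Matrix (Fin 2) (Fin 2) F) i j) ≤ WithZero.exp (((2 * N : ℕ) : ℤ))) ∧
        WithZero.exp (-((4 * N : ℕ) : ℤ)) ≤ Valued.v (h : Matrix (Fin 2) (Fin 2) F).det ∧
        Valued.v ((h : Matrix (Fin 2) (Fin 2) F) 0 1) ≤ WithZero.exp (((2 * N : ℕ) : ℤ) - a) := by
      rintro z ⟨hz1, hz2⟩
      obtain ⟨h, rfl, hle1, hone⟩ := exists_normalized_lift hϖ hϖ0 z
      have hb0 := hN h hz1
      have hdet : WithZero.exp (-(4 * (N : ℤ))) ≤ Valued.v (h : Matrix (Fin 2) (Fin 2) F).det := v_det_ge_of_scaleBound h hb0 hone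
      have hconj : (QuotientGroup.mk (tt a * h * (tt a)⁻¹) : GL (Fin 2) F ⧸ Subgroup.center (GL (Fin 2) F)) ∈ Ω := by
        rw [QuotientGroup.mk_mul, QuotientGroup.mk_mul, QuotientGroup.mk_inv, ← htmk]; exact hz2
      have hb1 := hN _ hconj
      have hyM : ∀ i j, Valued.v (((tt a * h * (tt a)⁻¹ : GL (Fin 2) F) : Matrix (Fin 2) (Fin 2) F) i j) ≤ WithZero.exp (2 * (N : ℤ)) :=
        fun i j => entries_le_of_scaleBound_of_one_le_v_det_inv _ hb1 (one_le_v_det_conj_inv (tt a) h hle1) i j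
      have hyM' : ∀ i j, Valued.v (((zpowDiagGL hϖ0 ![-(a : ℤ), 0] * h * (zpowDiagGL hϖ0 ![-(a : ℤ), 0])⁻¹ : GL (Fin 2) F) :
          Matrix (Fin 2) (Fin 2) F) i j) ≤ WithZero.exp (((2 * N : ℕ) : ℤ)) := by
        intro i j; rw [Nat.cast_mul, Nat.cast_ofNat]; exact hyM i j
      have h01 := v_upper_le_of_conj_tOne hϖ hϖ0 a (2 * N) h hyM'
      refine ⟨h, rfl, fun i j => (hle1 i j).trans ?_, by push_cast; exact hdet, h01⟩
      rw [← WithZero.exp_zero]; exact WithZero.exp_le_exp.2 (by positivity)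
    -- THE ONE SHAPE: `d = a`, `k = (a − 8N − 1)/2`, `j = k − 12N`
    set k : ℕ := (a - 8 * N - 1) / 2 with hk
    set j : ℕ := k - 12 * N with hj
    have hd1 : 4 * (2 * N) + 2 * k + 1 ≤ a := by omega
    have hd2 : 2 * (2 * N) + 4 * N < a := by omega
    have hkj : (k : ℤ) = j + 12 * N := by push_cast [hj]; omega
    have hja : a ≤ 4 * j + c := by omega
    have hsub : box ∩ {z | IsCompact ((Subgroup.centralizer ({z} : Set (GL (Fin 2) F ⧸ Subgroup.center (GL (Fin 2) F)))) : Set (GL (Fin 2) F ⧸ Subgroup.center (GL (Fin 2) F)))} ⊆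
        box ∩ (QuotientGroup.mk : GL (Fin 2) F → GL (Fin 2) F ⧸ Subgroup.center (GL (Fin 2) F)) ''
          {h : GL (Fin 2) F | Valued.v (((h : Matrix (Fin 2) (Fin 2) F) 0 0 - (h : Matrix (Fin 2) (Fin 2) F) 1 1) ^ 2) <
            WithZero.exp (-(j : ℤ)) * Valued.v ((h : Matrix (Fin 2) (Fin 2) F) 0 0) ^ 2} := by
      rintro z ⟨hz, hZ⟩
      refine ⟨hz, ?_⟩
      obtain ⟨h, rfl, hall, hdet, h01⟩ := hlift z hz
      have hQ : Valued.v (((h : Matrix (Fin 2) (Fin 2) F) 0 0 - (h : Matrix (Fin 2) (Fin 2) F) 1 1) ^ 2) < WithZero.exp (-(k : ℤ)) :=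
        v_diffSq_lt_of_isCompact_centralizer hϖ hd1 h hall h01 hZ
      have h00 := (v_diag_ge_shape hd2 h hall h01 hdet).2.1
      refine ⟨h, ?_, rfl⟩
      rw [mem_setOf_eq]
      refine hQ.trans_le ?_
      rw [hkj, neg_add, WithZero.exp_add]
      refine mul_le_mul' le_rfl ?_
      have hsq := pow_le_pow_left' h00 2
      refine le_trans (le_of_eq ?_) hsq
      rw [pow_two, ← WithZero.exp_add]; congr 1; push_cast; ring
    exact (measure_mono hsub).trans ((h5 j box hboxm htorusI).trans
      ((mul_le_mul' (hεmaj a j hja) le_rfl).trans_eq (mul_comm _ _)))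
  -- §6 the generic assembly ★ F3a‴
  exact lintegral_fibre_lt_top_of_boxDecay_of_admissible μ Kb hKo hKc t hcov Ω hΩl hΩr Fs hΩF hCΩ hβ hβΩ hMb hβM ε hεsum hdecay hAC hAZ

end Main

/-! ## §3 The assembled heads (★ 2E-b1 with `hFC := finConjGL_of_admissible hϖ μ`) -/

section Assembled

variable {F : Type*} [Field F] [Valued F ℤᵐ⁰] [ValuativeRel F] [(Valued.v : Valuation F ℤᵐ⁰).Compatible] [IsNonarchimedeanLocalField F] [CharZero F]
  {ϖ : F} (hϖ : Valued.v ϖ = WithZero.exp (-1 : ℤ))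
  [MeasurableSpace (GL (Fin 2) F ⧸ Subgroup.center (GL (Fin 2) F))] [BorelSpace (GL (Fin 2) F ⧸ Subgroup.center (GL (Fin 2) F))]
  (μ : Measure (GL (Fin 2) F ⧸ Subgroup.center (GL (Fin 2) F))) [μ.IsHaarMeasure]

include hϖ in
/-- **(FC) on `Ḡ = GL₂(F) ⧸ Z`, COMPACT-CENTRALISER DOMAIN, UNCONDITIONAL**: `∫⁻_{C ∩ {Z_Ḡ(ḡ) compact}} ∫⁻ β(x̄ ḡ x̄⁻¹) dμ̄ dμ̄ < ⊤` (★ 2E-b1 `finConjGL_cc` at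
`hFC := finConjGL_of_admissible hϖ μ`) — the form consumed by the central-quotient transfer (2E-b2) and the elliptic package (2E-c). [cite: HarishChandra1970, Part VII §2 p. 69]
[cite: JacquetLanglands1970, §7] -/
theorem finConjGL_cc {C : Set (GL (Fin 2) F ⧸ Subgroup.center (GL (Fin 2) F))} (hC : IsCompact C)
    {β : (GL (Fin 2) F ⧸ Subgroup.center (GL (Fin 2) F)) → ℝ≥0∞} (hβ : Continuous β) (hβs : IsCompact (tsupport β))
    {Mb : ℝ≥0∞} (hMb : Mb ≠ ⊤) (hβM : ∀ g, β g ≤ Mb) :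
    ∫⁻ g in C ∩ {h : GL (Fin 2) F ⧸ Subgroup.center (GL (Fin 2) F) | IsCompact ((Subgroup.centralizer ({h} : Set (GL (Fin 2) F ⧸ Subgroup.center (GL (Fin 2) F)))) :
        Set (GL (Fin 2) F ⧸ Subgroup.center (GL (Fin 2) F)))}, ∫⁻ x, β (x * g * x⁻¹) ∂μ ∂μ < ⊤ :=
  K2E3GL2FinConjAdmissible.finConjGL_cc μ (fun hC' => finConjGL_of_admissible hϖ μ hC') hC hβ hβs hMb hβM

include hϖ in
/-- **(FC) on `Ḡ = GL₂(F) ⧸ Z`, FINITE-FIBRE DOMAIN, UNCONDITIONAL**: `∫⁻_{C ∩ {W(ḡ) < ⊤}} W dμ̄ < ⊤`, `W(ḡ) = ∫⁻ β(x̄ ḡ x̄⁻¹) dμ̄(x̄)` — the `N = 2` twin of ★ (GL-3b)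
`K2E3GL3FinConj.finConjGL` (★ 2E-b1 `finConjGL` at `hFC := finConjGL_of_admissible hϖ μ`; admissibility by ★ F2). [cite: HarishChandra1970, Part VII §2 p. 69]
[cite: JacquetLanglands1970, §7] -/
theorem finConjGL {C : Set (GL (Fin 2) F ⧸ Subgroup.center (GL (Fin 2) F))} (hC : IsCompact C)
    {β : (GL (Fin 2) F ⧸ Subgroup.center (GL (Fin 2) F)) → ℝ≥0∞} (hβ : Continuous β) (hβs : IsCompact (tsupport β))
    {Mb : ℝ≥0∞} (hMb : Mb ≠ ⊤) (hβM : ∀ g, β g ≤ Mb) :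
    ∫⁻ g in C ∩ {g : GL (Fin 2) F ⧸ Subgroup.center (GL (Fin 2) F) | ∫⁻ x, β (x * g * x⁻¹) ∂μ < ⊤}, ∫⁻ x, β (x * g * x⁻¹) ∂μ ∂μ < ⊤ :=
  K2E3GL2FinConjAdmissible.finConjGL hϖ μ (fun hC' => finConjGL_of_admissible hϖ μ hC') hC hβ hβs hMb hβM

end Assembled

end Summit.HodgeConjecture.HodgeConjecture.Cruxes.H413.K2E3GL2FinConj
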